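import Summits.KontsevichZagierPeriods.KontsevichZagierPeriods.Theorems.ValuedFieldSpecialisationDefs

/-!
# Route ValuedFieldSpecialisation — crux `CTConstruction`: expansion of the blown-up family over the block

Helper toward crux stmt-KontsevichZagierPeriods-3495 (`CTConstruction`), line `registered`,
reshape r4 (blow-up elimination of the log block), stub `stub_blowup_expansion`. A **typed
family** over the elementary data `(p, q, B, d, r)` with types `a c : Fin B → ℕ` is a
representation `R : KZ.IntegralRep (B + d + 3)` with coordinates `z = (σ, s', v, t, w)`
(`σ = z 0` the parameter, `s' = z 1`, `v = z 2`, the block `t : Fin B → ℝ`, the fibre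
`w : Fin d → ℝ`), domain `0 < σ < 1`, `0 < s' < 1`, `0 < v`, `v ^ q σ ^ p < 1`,
`σ ^ (a j) s' ^ (c j) ≤ t j ≤ 1`, `w ∈ r.domain`, and integrand
`s' ^ (1 - p/q) · ∏ (t j)⁻¹ · r.integrand w`. The recast sheared blow-up of an elementary
divergent product is the typed family all of whose block coordinates have type `(1, 1)` (lower
bound `σ s'`). ASSUMING the one-coordinate splitting law (hypothesis `hsplit`, the statement of
the companion stub `stub_blowup_split`: a coordinate of type `(1, 1)` splits, modulo fibred
relations, into one of type `(1, 0)` plus one of type `(0, 1)`), we iterate it over all block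
coordinates (`blowupExpansion_aux`, a Finset induction with the bookkeeping
`∑_{T ⊆ insert j U} = ∑_{T ⊆ U} + ∑_{T ⊆ U} (insert j ·)`): the type-`(1, 1)` family `F`
satisfies `[F] ≡ ∑_S [f S]` modulo FIBRED relations, where `S ⊆ Fin B` records the coordinates
of type `(0, 1)` and `f S` is the typed family of types `a_S = 𝟙[∉ S]`, `c_S = 𝟙[∈ S]`. This is
a transcription of `typedExpansion_aux` / `stub_typedExpansion` of
`…CTConstructionTypedExpansion.lean` with the pair of ℕ-valued type functions `(a, c)` in place
of `(κ, e)`.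

Sources: M. Kontsevich, D. Zagier, *Periods* (2001), §1.2 (rules (1)–(2)); J. Bochnak, M. Coste,
M.-F. Roy, *Real Algebraic Geometry* (1998), §2.2 (semialgebraic maps, used only through the
hypothesis `hsplit`). No new definitions.
-/

noncomputable section

namespace Summit.KontsevichZagierPeriods.ValuedFieldSpecialisation

open MeasureTheory Set Filter
open scoped Topology
open Literature.NumberTheory.Transcendental Literature.NumberTheory.Transcendental.KZ

/-! ## Iterated splitting: the abstract bookkeeping -/

/-- **Iterated splitting of block coordinates.** Let `D a c` be a "domain former" indexed by two
exponent functions `a c : Fin B → ℕ` (the type of the coordinate `t j` being `(a j, c j)`, i.e.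
the lower bound `σ ^ (a j) * s' ^ (c j) ≤ t j`), and `I` an integrand, such that every
representation of shape `(a, c)` with `a j = 1`, `c j = 1` splits, modulo fibred relations, into
one of shape `(a, update c j 0)` plus one of shape `(update a j 0, c)`. Then a representation
`X` of shape `(a, c)` with `a j = c j = 1` on a finset `U` of positions expands as
`[X] ≡ ∑_{T ⊆ U} [g T]`, where `g T` has the shape obtained from `(a, c)` by `a j := 0` on `T`
and `c j := 0` on `U \ T` (induction on `U`, `Finset.sum_powerset_insert`). [folklore] -/
theorem blowupExpansion_aux {B n : ℕ} (D : (Fin B → ℕ) → (Fin B → ℕ) → Set (Fin n → ℝ))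
    (I : (Fin n → ℝ) → ℝ)
    (hsplit : ∀ (a c : Fin B → ℕ) (j : Fin B) (X : IntegralRep n), a j = 1 → c j = 1 →
      X.domain = D a c → X.integrand = I → ∃ X₁ X₂ : IntegralRep n,
        X₁.domain = D a (Function.update c j 0) ∧ X₁.integrand = I ∧
        X₂.domain = D (Function.update a j 0) c ∧ X₂.integrand = I ∧
        of X - of X₁ - of X₂ ∈ fibredRelations)
    (U : Finset (Fin B)) :
    ∀ (a c : Fin B → ℕ) (X : IntegralRep n), (∀ j ∈ U, a j = 1) → (∀ j ∈ U, c j = 1) →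
      X.domain = D a c → X.integrand = I →
      ∃ g : Finset (Fin B) → IntegralRep n,
        (∀ T ⊆ U, ∀ (a' c' : Fin B → ℕ),
          (∀ j, a' j = if j ∈ T then 0 else a j) → (∀ j, c' j = if j ∈ U \ T then 0 else c j) →
          (g T).domain = D a' c' ∧ (g T).integrand = I) ∧
        of X - ∑ T ∈ U.powerset, of (g T) ∈ fibredRelations := by
  induction U using Finset.induction_on with
  | empty =>
    intro a c X _ _ hX hXi
    refine ⟨fun _ => X, fun T hT a' c' ha' hc' => ?_, ?_⟩
    · obtain rfl : T = ∅ := Finset.subset_empty.mp hT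
      obtain rfl : a' = a := funext fun j => by simpa using ha' j
      obtain rfl : c' = c := funext fun j => by simpa using hc' j
      exact ⟨hX, hXi⟩
    · rw [Finset.powerset_empty, Finset.sum_singleton, sub_self]
      exact fibredRelations.zero_mem
  | insert j U₀ hj ih =>
    intro a c X ha hc hX hXi
    obtain ⟨X₁, X₂, hX₁, hX₁i, hX₂, hX₂i, hrel⟩ := hsplit a c j X
      (ha j (Finset.mem_insert_self j U₀)) (hc j (Finset.mem_insert_self j U₀)) hX hXi
    -- expand `X₁` (shape `(a, update c j 0)`) and `X₂` (shape `(update a j 0, c)`) over `U₀`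
    obtain ⟨g₁, hg₁, hrel₁⟩ := ih a (Function.update c j 0) X₁
      (fun j' hj' => ha j' (Finset.mem_insert_of_mem hj'))
      (fun j' hj' => by
        rw [Function.update_of_ne (ne_of_mem_of_not_mem hj' hj)]
        exact hc j' (Finset.mem_insert_of_mem hj')) hX₁ hX₁i
    obtain ⟨g₂, hg₂, hrel₂⟩ := ih (Function.update a j 0) c X₂
      (fun j' hj' => by
        rw [Function.update_of_ne (ne_of_mem_of_not_mem hj' hj)]
        exact ha j' (Finset.mem_insert_of_mem hj'))
      (fun j' hj' => hc j' (Finset.mem_insert_of_mem hj')) hX₂ hX₂i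
    refine ⟨fun T => if j ∈ T then g₂ (T.erase j) else g₁ T, fun T hT a' c' ha' hc' => ?_, ?_⟩
    · dsimp only
      by_cases hjT : j ∈ T
      · -- the pieces containing `j` (type `(0, 1)` at `j`) come from `X₂`
        rw [if_pos hjT]
        refine hg₂ (T.erase j) (Finset.subset_insert_iff.mp hT) a' c' (fun j' => ?_)
          (fun j' => ?_)
        · rw [ha' j']
          by_cases h : j' = j
          · subst h
            simp [hjT]
          · simp [h]
        · rw [hc' j']
          by_cases h : j' = j
          · subst h
            simp [hj, hjT]
          · simp [h]
      · -- the pieces avoiding `j` (type `(1, 0)` at `j`) come from `X₁`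
        rw [if_neg hjT]
        have hT' : T ⊆ U₀ := fun x hx =>
          (Finset.mem_insert.mp (hT hx)).resolve_left fun h => hjT (h ▸ hx)
        refine hg₁ T hT' a' c' ha' (fun j' => ?_)
        rw [hc' j']
        by_cases h : j' = j
        · subst h
          simp [hj, hjT]
        · simp [h]
    · rw [Finset.sum_powerset_insert hj]
      have h1 : ∑ T ∈ U₀.powerset, of (if j ∈ T then g₂ (T.erase j) else g₁ T) =
          ∑ T ∈ U₀.powerset, of (g₁ T) :=
        Finset.sum_congr rfl fun T hT => by
          rw [if_neg fun h => hj (Finset.mem_powerset.mp hT h)]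
      have h2 : ∑ T ∈ U₀.powerset,
          of (if j ∈ insert j T then g₂ ((insert j T).erase j) else g₁ (insert j T)) =
          ∑ T ∈ U₀.powerset, of (g₂ T) :=
        Finset.sum_congr rfl fun T hT => by
          rw [if_pos (Finset.mem_insert_self j T),
            Finset.erase_insert fun h => hj (Finset.mem_powerset.mp hT h)]
      rw [h1, h2]
      have hsum : of X - (∑ T ∈ U₀.powerset, of (g₁ T) + ∑ T ∈ U₀.powerset, of (g₂ T)) =
          (of X - of X₁ - of X₂) + (of X₁ - ∑ T ∈ U₀.powerset, of (g₁ T)) +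
            (of X₂ - ∑ T ∈ U₀.powerset, of (g₂ T)) := by
        abel
      rw [hsum]
      exact fibredRelations.add_mem (fibredRelations.add_mem hrel hrel₁) hrel₂

/-! ## The stub -/

/-- **Stub `stub_blowup_expansion` (expansion of the blown-up family over the block).** Assuming
the one-coordinate splitting law `hsplit` (a block coordinate of type `(1, 1)` splits, modulo
fibred relations, into one of type `(1, 0)` plus one of type `(0, 1)`), the typed family `F` all of
whose block coordinates have type `(1, 1)` satisfies `[F] - ∑_S [f S] ∈ fibredRelations` for typed
families `f S` of types `a_S j = 𝟙[j ∉ S]`, `c_S j = 𝟙[j ∈ S]` (`blowupExpansion_aux` over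
`Finset.univ`, starting from `a = c = 1`, the pieces being indexed by the set `S` of coordinates
of type `(0, 1)`; `Finset.powerset_univ`). [Kontsevich–Zagier 2001, §1.2 rules (1)–(2)]
[folklore] -/
theorem stub_blowup_expansion : ∀ (p q B d : ℕ) (r : Literature.NumberTheory.Transcendental.KZ.IntegralRep d) (F : Literature.NumberTheory.Transcendental.KZ.IntegralRep (B + d + 1 + 1 + 1)), (∀ (a c : Fin B → ℕ) (j : Fin B) (R : Literature.NumberTheory.Transcendental.KZ.IntegralRep (B + d + 1 + 1 + 1)), a j = 1 → c j = 1 → R.domain = {z | ∃ (σ s' v : ℝ) (t : Fin B → ℝ) (w : Fin d → ℝ), z = Matrix.vecCons σ (Matrix.vecCons s' (Matrix.vecCons v (Fin.append t w))) ∧ 0 < σ ∧ σ < 1 ∧ 0 < s' ∧ s' < 1 ∧ 0 < v ∧ v ^ q * σ ^ p < 1 ∧ (∀ j', σ ^ (a j') * s' ^ (c j') ≤ t j' ∧ t j' ≤ 1) ∧ w ∈ r.domain} → R.integrand = (fun z => z 1 ^ ((1 - (p : ℚ) / q : ℚ) : ℝ) * ((∏ j : Fin B, (z (Fin.castAdd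 d j).succ.succ.succ)⁻¹) * r.integrand (fun l : Fin d => z (Fin.natAdd B l).succ.succ.succ))) → ∃ R₁ R₂ : Literature.NumberTheory.Transcendental.KZ.IntegralRep (B + d + 1 + 1 + 1), R₁.domain = {z | ∃ (σ s' v : ℝ) (t : Fin B → ℝ) (w : Fin d → ℝ), z = Matrix.vecCons σ (Matrix.vecCons s' (Matrix.vecCons v (Fin.append t w))) ∧ 0 < σ ∧ σ < 1 ∧ 0 < s' ∧ s' < 1 ∧ 0 < v ∧ v ^ q * σ ^ p < 1 ∧ (∀ j', σ ^ (a j') * s' ^ (Function.update c j 0 j') ≤ t j' ∧ t j' ≤ 1) ∧ w ∈ r.domain} ∧ R₁.integrand = (fun z => z 1 ^ ((1 - (p : ℚ) / q : ℚ) : ℝ) * ((∏ j : Fin B, (z (Fin.castAdd d j).succ.succ.succ)⁻¹) * r.integrand (fun l : Fin d => z (Fin.natAdd B l).succ.succ.succ))) ∧ R₂.domain = {z | ∃ (σ s' v : ℝ) (t : Fin B → ℝ) (w : Fin d → ℝ), z = Matrix.vecCons σ (Matrix.vecCons s' (Matrix.vecCons v (Fin.append t w))) ∧ 0 < σ ∧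 σ < 1 ∧ 0 < s' ∧ s' < 1 ∧ 0 < v ∧ v ^ q * σ ^ p < 1 ∧ (∀ j', σ ^ (Function.update a j 0 j') * s' ^ (c j') ≤ t j' ∧ t j' ≤ 1) ∧ w ∈ r.domain} ∧ R₂.integrand = (fun z => z 1 ^ ((1 - (p : ℚ) / q : ℚ) : ℝ) * ((∏ j : Fin B, (z (Fin.castAdd d j).succ.succ.succ)⁻¹) * r.integrand (fun l : Fin d => z (Fin.natAdd B l).succ.succ.succ))) ∧ Literature.NumberTheory.Transcendental.KZ.of R - Literature.NumberTheory.Transcendental.KZ.of R₁ - Literature.NumberTheory.Transcendental.KZ.of R₂ ∈ Literature.NumberTheory.Transcendental.KZ.fibredRelations) → F.domain = {z | ∃ (σ s' v : ℝ) (t : Fin B → ℝ) (w : Fin d → ℝ), z = Matrix.vecCons σ (Matrix.vecCons s' (Matrix.vecCons v (Fin.append t w))) ∧ 0 < σ ∧ σ < 1 ∧ 0 < s' ∧ s' < 1 ∧ 0 < v ∧ v ^ q * σ ^ p < 1 ∧ (∀ j, σ ^ (1 : ℕ) * s' ^ (1 : ℕ) ≤ t j ∧ t j ≤ 1) ∧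 w ∈ r.domain} → F.integrand = (fun z => z 1 ^ ((1 - (p : ℚ) / q : ℚ) : ℝ) * ((∏ j : Fin B, (z (Fin.castAdd d j).succ.succ.succ)⁻¹) * r.integrand (fun l : Fin d => z (Fin.natAdd B l).succ.succ.succ))) → ∃ f : Finset (Fin B) → Literature.NumberTheory.Transcendental.KZ.IntegralRep (B + d + 1 + 1 + 1), (∀ S : Finset (Fin B), (f S).domain = {z | ∃ (σ s' v : ℝ) (t : Fin B → ℝ) (w : Fin d → ℝ), z = Matrix.vecCons σ (Matrix.vecCons s' (Matrix.vecCons v (Fin.append t w))) ∧ 0 < σ ∧ σ < 1 ∧ 0 < s' ∧ s' < 1 ∧ 0 < v ∧ v ^ q * σ ^ p < 1 ∧ (∀ j, σ ^ (if j ∈ S then 0 else 1) * s' ^ (if j ∈ S then 1 else 0) ≤ t j ∧ t j ≤ 1) ∧ w ∈ r.domain} ∧ (f S).integrand = (fun z => z 1 ^ ((1 - (p : ℚ) / q : ℚ) : ℝ) * ((∏ j : Fin B, (z (Fin.castAdd d j).succ.succ.succ)⁻¹) * r.integrand (fun l : Fin d => z (Fin.natAdd B l).succ.succ.succ)))) ∧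 Literature.NumberTheory.Transcendental.KZ.of F - ∑ S : Finset (Fin B), Literature.NumberTheory.Transcendental.KZ.of (f S) ∈ Literature.NumberTheory.Transcendental.KZ.fibredRelations := by
  intro p q B d r F hsplit hF hFi
  -- Step 1: iterate the splitting law over all block coordinates, starting from `a = c = 1`
  obtain ⟨g, hg, hrel⟩ := blowupExpansion_aux
    (fun (a c : Fin B → ℕ) => {z : Fin (B + d + 1 + 1 + 1) → ℝ | ∃ (σ s' v : ℝ) (t : Fin B → ℝ)
      (w : Fin d → ℝ), z = Matrix.vecCons σ (Matrix.vecCons s' (Matrix.vecCons v (Fin.append t w))) ∧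
      0 < σ ∧ σ < 1 ∧ 0 < s' ∧ s' < 1 ∧ 0 < v ∧ v ^ q * σ ^ p < 1 ∧
      (∀ j, σ ^ (a j) * s' ^ (c j) ≤ t j ∧ t j ≤ 1) ∧ w ∈ r.domain})
    (fun z => z 1 ^ ((1 - (p : ℚ) / q : ℚ) : ℝ) *
      ((∏ j : Fin B, (z (Fin.castAdd d j).succ.succ.succ)⁻¹) *
        r.integrand (fun l : Fin d => z (Fin.natAdd B l).succ.succ.succ)))
    (fun a c j X haj hcj hXd hXi => hsplit a c j X haj hcj hXd hXi) Finset.univ (fun _ => 1)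
    (fun _ => 1) F (fun _ _ => rfl) (fun _ _ => rfl) hF hFi
  -- Step 2: the pieces are indexed by the set `S` of coordinates of type `(0, 1)`
  refine ⟨g, fun S => ?_, ?_⟩
  · exact hg S (Finset.subset_univ S) (fun j => if j ∈ S then 0 else 1)
      (fun j => if j ∈ S then 1 else 0) (fun _ => rfl)
      (fun j => by by_cases hjS : j ∈ S <;> simp [hjS])
  · simpa only [Finset.powerset_univ] using hrel

end Summit.KontsevichZagierPeriods.ValuedFieldSpecialisation
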